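import Literature.AlgebraicGeometry.Motives.CyclesPushforwardFibre
import Literature.RingTheory.OrderOfVanishing.NormOrdExtension
import Mathlib.AlgebraicGeometry.ZariskisMainTheorem
import HarnessLib

/-!
# `p_* div(f) = div(Nm f)` (Stacks 02RT)

Discharge of `Literature.AlgebraicGeometry.Motives.map_div_eq_div_norm`.

Stacks, Chow Homology, Lemma 42.18.1 (Tag 02RT): for `p : X → Y` a proper dominant morphism of
integral schemes locally of finite type over a field with `dim X = dim Y` and `f ∈ K(X)^*`,
`p_* div_X(f) = div_Y(Nm_{K(X)/K(Y)}(f))`.  The printed proof: "replace `Y` by an affine open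
neighbourhood of `ξ` [Tag 02RM] and assume that `p : X → Y` is finite. Write `Y = Spec(R)` and
`X = Spec(A)` with `p` induced by a finite homomorphism `R → A` of Noetherian domains which induces
a finite field extension `L/K` of fraction fields ... The coefficient of `[Z]` in `div_Y(g)` is
`ord_{R_𝔭}(g)`. The coefficient of `[Z]` in `p_* div_X(f)` is
`Σ_{𝔮 lying over 𝔭} [κ(𝔮):κ(𝔭)] ord_{A_𝔮}(f)`. The desired equality therefore follows from
Algebra, Lemma 10.121.8 [Tag 02MJ]."  We follow it, with Tag 02RM from
`Motives/CyclesPushforwardFibre` and Tag 02MJ from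
`Literature.RingTheory.OrderOfVanishing.ordFrac_norm_eq_finsum_primesOver`
(`RingTheory/OrderOfVanishing/NormOrdExtension`).  Contents:

* chart dictionary — `Literature.AlgebraicGeometry.Motives.comap_app_primeIdealOf` (the prime of
  `x ∈ p⁻¹U = Spec A` lies over the prime of `p x ∈ U = Spec R`),
  `Literature.AlgebraicGeometry.Motives.functionFieldMap_germToFunctionField` (`p^♯ : K(Y) → K(X)`
  extends `p^*` on sections),
  `Literature.AlgebraicGeometry.Motives.finiteDimensional_of_isFractionRing`,
  `Literature.AlgebraicGeometry.Motives.ord_germToFunctionField_eq` (Mathlib's `Scheme.ord` of a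
  section at a codimension-one point of `Spec A` is `ord_{A_𝔮}`),
  `Literature.AlgebraicGeometry.Motives.residueDegree_eq_inertiaDeg` (Mathlib's
  `p.residueDegree x` is `[κ(𝔮_x) : κ(𝔭_{px})]`, Mathlib `Ideal.inertiaDeg`),
  `Literature.AlgebraicGeometry.Motives.exists_isAffineOpen_finite_app` (a finite affine chart
  from Tag 02RM);
* the two coefficients — `Literature.AlgebraicGeometry.Motives.ord_norm_germToFunctionField_eq`
  (`ord_y(Nm b) = Σ_{𝔮 ∣ 𝔭} [κ(𝔮):κ(𝔭)] ord_{A_𝔮}(b)`, by Tag 02MJ) and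
  `Literature.AlgebraicGeometry.Motives.finsum_ord_mul_residueDegree_eq` (the coefficient of `y`
  in `p_* div(b)` is the same sum, through the bijection `x ↦ 𝔮_x` of the fibre with the primes
  over `𝔭`);
* `Literature.AlgebraicGeometry.Motives.map_div_eq_div_norm_holds` — the discharge.

Everything here is proved; there are no definitions and no named facts.

## References

* [StacksProject] The Stacks Project, Chow Homology, Lemma 42.18.1 (Tag 02RT) and its proof,
  Lemma 42.16.2 (Tag 02RM); Algebra, Lemma 10.121.8 (Tag 02MJ).
* [Fulton1998] W. Fulton, *Intersection Theory*, 2nd ed. (1998), Prop. 1.4 (b), proof, Case 2.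
-/

open CategoryTheory AlgebraicGeometry Order Topology TopologicalSpace
  Literature.RingTheory.OrderOfVanishing

universe u

noncomputable section

namespace Literature.AlgebraicGeometry.Motives

/-! ### Points and primes along a morphism of affine opens -/

section Chart

variable {X Y : Scheme.{u}} (p : X ⟶ Y) {U : Y.Opens} (hU : IsAffineOpen U)
  (hU' : IsAffineOpen (p ⁻¹ᵁ U))

/-- For `x ∈ p⁻¹(U)`, `U` affine with affine preimage, the prime of `Γ(X, p⁻¹U)` at `x` lies over
the prime of `Γ(Y, U)` at `p x` along `p^* : Γ(Y, U) → Γ(X, p⁻¹U)` (naturality of `fromSpec`,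
Mathlib `IsAffineOpen.SpecMap_appLE_fromSpec`). [folklore] -/
theorem comap_app_primeIdealOf (x : p ⁻¹ᵁ U) :
    (hU'.primeIdealOf x).asIdeal.comap (p.app U).hom =
      (hU.primeIdealOf ⟨p.base x, x.2⟩).asIdeal := by
  have h1 : Spec.map (p.appLE U (p ⁻¹ᵁ U) le_rfl) ≫ hU.fromSpec = hU'.fromSpec ≫ p :=
    IsAffineOpen.SpecMap_appLE_fromSpec p hU hU' le_rfl
  have h2 : hU.fromSpec (Spec.map (p.appLE U (p ⁻¹ᵁ U) le_rfl) (hU'.primeIdealOf x)) =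
      p.base x := by
    rw [← Scheme.Hom.comp_apply, h1, Scheme.Hom.comp_apply, IsAffineOpen.fromSpec_primeIdealOf]
  have h3 : Spec.map (p.appLE U (p ⁻¹ᵁ U) le_rfl) (hU'.primeIdealOf x) =
      hU.primeIdealOf ⟨p.base x, x.2⟩ := by
    apply hU.fromSpec.isOpenEmbedding.injective
    rw [h2, IsAffineOpen.fromSpec_primeIdealOf]
  rw [Scheme.Hom.app_eq_appLE]
  exact congrArg PrimeSpectrum.asIdeal h3

end Chart

/-! ### Function fields along a dominant morphism, on sections -/

section FunctionField

variable {X Y : Scheme.{u}} [IsIntegral X] [IsIntegral Y] (p : X ⟶ Y) [IsDominant p]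

/-- Compatibility of `p^♯ : K(Y) → K(X)` (`RatFn.functionFieldMap`) with the maps on sections:
for `r ∈ Γ(Y, U)`, `p^♯(r|_{K(Y)}) = (p^* r)|_{K(X)}`. [folklore] -/
theorem functionFieldMap_germToFunctionField (U : Y.Opens) [Nonempty U]
    [Nonempty (p ⁻¹ᵁ U)] (r : Γ(Y, U)) (x : X) (hx : p.base x ∈ U) :
    RatFn.functionFieldMap p (Y.germToFunctionField U r) =
      X.germToFunctionField (p ⁻¹ᵁ U) (p.app U r) := by
  rw [← Y.algebraMap_germ_eq_germToFunctionField hx]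
  change RatFn.functionFieldMap p (RatFn.toFunctionField (p.base x) _) = _
  rw [RatFn.functionFieldMap_toFunctionField, ← CategoryTheory.ConcreteCategory.comp_apply,
    Scheme.Hom.germ_stalkMap, CategoryTheory.ConcreteCategory.comp_apply]
  exact X.algebraMap_germ_eq_germToFunctionField (U := p ⁻¹ᵁ U) hx (p.app U r)

end FunctionField

/-! ### The function field extension of a finite extension of domains is finite -/

section FracFinite

/-- For a finite extension of domains `R ⊆ S`, `Frac S` is finite over `Frac R` (`Frac S` is the
localisation of `S` at `R ∖ 0`, Mathlib
`Algebra.IsAlgebraic.instIsLocalizationAlgebraMapSubmonoidNonZeroDivisors`). [folklore] -/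
theorem finiteDimensional_of_isFractionRing (R S K L : Type*) [CommRing R] [IsDomain R]
    [CommRing S] [IsDomain S] [Algebra R S] [Module.Finite R S] [FaithfulSMul R S] [Field K]
    [Field L] [Algebra R K] [IsFractionRing R K] [Algebra S L] [IsFractionRing S L] [Algebra K L]
    [Algebra R L] [IsScalarTower R S L] [IsScalarTower R K L] : FiniteDimensional K L :=
  haveI : Algebra.IsIntegral R S := Algebra.IsIntegral.of_finite R S
  haveI := Algebra.IsAlgebraic.instIsLocalizationAlgebraMapSubmonoidNonZeroDivisors R S L
  Module.Finite.of_isLocalization R S (nonZeroDivisors R)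

end FracFinite

/-! ### Orders of vanishing on an affine chart -/

section OrdChart

variable {X : Scheme.{u}} [IsIntegral X] [IsLocallyNoetherian X] {V : X.Opens} (hV : IsAffineOpen V)

/-- **`ord_x` read on an affine chart**: for `x ∈ V = Spec S` of codimension one with prime
`𝔮 = 𝔮_x ⊂ S` and `b ∈ S`, Mathlib's `Scheme.ord (b|_{K(X)}) x` is
`ord_{S_𝔮}(b) = ℓ(S_𝔮 / b S_𝔮)` (`𝒪_{X,x} = S_𝔮`, Mathlib `IsAffineOpen.isLocalization_stalk`).
[folklore] -/
theorem ord_germToFunctionField_eq (x : V) (hxc : coheight (x : X) = 1) (b : Γ(X, V))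
    (hb : b ≠ 0) :
    haveI : Nonempty V := ⟨x⟩
    Scheme.ord (X.germToFunctionField V b) (x : X) =
      ((Ring.ord (Localization.AtPrime (hV.primeIdealOf x).asIdeal)
        (algebraMap Γ(X, V) (Localization.AtPrime (hV.primeIdealOf x).asIdeal) b)).toNat : ℤ) := by
  haveI : Nonempty V := ⟨x⟩
  haveI : Ring.KrullDimLE 1 (X.presheaf.stalk (x : X)) := krullDimLE_of_coheight_le hxc.le
  haveI := hV.isLocalization_stalk x
  -- `𝒪_{X,x} ≅ S_𝔮` as `S`-algebras
  let e := IsLocalization.algEquiv (hV.primeIdealOf x).asIdeal.primeCompl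
    (X.presheaf.stalk (x : X)) (Localization.AtPrime (hV.primeIdealOf x).asIdeal)
  have hgerm : X.presheaf.germ V x x.2 b = algebraMap Γ(X, V) (X.presheaf.stalk (x : X)) b := by
    rw [TopCat.Presheaf.stalk_open_algebraMap]
  have hgerm0 : X.presheaf.germ V x x.2 b ≠ 0 :=
    (map_ne_zero_iff _ (germ_injective_of_isIntegral X (x : X) x.2)).mpr hb
  rw [Scheme.ord_eq_ordHom_of_coheight_eq_one hxc, Scheme.ordHom,
    ← X.algebraMap_germ_eq_germToFunctionField x.2 b, Ring.ordFrac_eq_ord _ hgerm0,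
    Ring.ordMonoidWithZeroHom_eq_coe _ (mem_nonZeroDivisors_of_ne_zero hgerm0)
      (ENat.coe_toNat (Ring.ord_ne_top (mem_nonZeroDivisors_of_ne_zero hgerm0))).symm,
    WithZero.unzeroD_coe, toAdd_ofAdd, hgerm, ← ord_ringEquiv e.toRingEquiv]
  congr 3
  change e (algebraMap Γ(X, V) (X.presheaf.stalk (x : X)) b) = _
  exact e.commutes b

end OrdChart

/-! ### Residue degrees on an affine chart -/

section DegChart

variable {X Y : Scheme.{u}} (p : X ⟶ Y) {U : Y.Opens} (hU' : IsAffineOpen (p ⁻¹ᵁ U))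

/-- **`[κ(x) : κ(p x)]` read on affine charts**: for `x ∈ p⁻¹(U)`, `U = Spec R` affine with
`p⁻¹U = Spec S` affine, Mathlib's `p.residueDegree x` is the residue degree
`[κ(𝔮_x) : κ(𝔭_{p x})]` (Mathlib `Ideal.inertiaDeg`) of the prime `𝔮_x ⊂ S` over `R` (both are
`[Frac(S/𝔮_x) : Frac(R/𝔭_{px})]`, the local rings being `R_𝔭`, `S_𝔮`). [folklore] -/
theorem residueDegree_eq_inertiaDeg (hU : IsAffineOpen U) (x : ↥(p ⁻¹ᵁ U)) :
    letI : Algebra Γ(Y, U) Γ(X, p ⁻¹ᵁ U) := (p.app U).hom.toAlgebra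
    p.residueDegree (x : X) = (hU'.primeIdealOf x).asIdeal.inertiaDeg Γ(Y, U) := by
  letI : Algebra Γ(Y, U) Γ(X, p ⁻¹ᵁ U) := (p.app U).hom.toAlgebra
  -- notation-free abbreviations of the local rings and residue fields would need `def`s; we
  -- register the relevant algebra structures by hand
  letI aY : Algebra Γ(Y, U) (Y.presheaf.stalk (p.base x)) :=
    TopCat.Presheaf.algebra_section_stalk Y.presheaf (⟨p.base x, x.2⟩ : U)
  haveI hloc : IsLocalization.AtPrime (Y.presheaf.stalk (p.base x))
      (hU.primeIdealOf ⟨p.base x, x.2⟩).asIdeal := hU.isLocalization_stalk ⟨p.base x, x.2⟩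
  haveI := hU'.isLocalization_stalk x
  haveI : (hU'.primeIdealOf x).asIdeal.LiesOver (hU.primeIdealOf ⟨p.base x, x.2⟩).asIdeal :=
    ⟨by rw [Ideal.under_def, RingHom.algebraMap_toAlgebra, comap_app_primeIdealOf p hU hU' x]⟩
  -- residue fields of the local rings: algebra structures over `R`, `R/𝔭`, `S`, `S/𝔮`
  letI aRk : Algebra Γ(Y, U) (IsLocalRing.ResidueField (Y.presheaf.stalk (p.base x))) :=
    inferInstanceAs (Algebra Γ(Y, U) (Y.presheaf.stalk (p.base x) ⧸
      IsLocalRing.maximalIdeal (Y.presheaf.stalk (p.base x))))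
  letI aRpk : Algebra (Γ(Y, U) ⧸ (hU.primeIdealOf ⟨p.base x, x.2⟩).asIdeal)
      (IsLocalRing.ResidueField (Y.presheaf.stalk (p.base x))) :=
    inferInstanceAs (Algebra (Γ(Y, U) ⧸ (hU.primeIdealOf ⟨p.base x, x.2⟩).asIdeal)
      (Y.presheaf.stalk (p.base x) ⧸ IsLocalRing.maximalIdeal (Y.presheaf.stalk (p.base x))))
  haveI : IsScalarTower Γ(Y, U) (Γ(Y, U) ⧸ (hU.primeIdealOf ⟨p.base x, x.2⟩).asIdeal)
      (IsLocalRing.ResidueField (Y.presheaf.stalk (p.base x))) :=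
    inferInstanceAs (IsScalarTower Γ(Y, U) (Γ(Y, U) ⧸ (hU.primeIdealOf ⟨p.base x, x.2⟩).asIdeal)
      (Y.presheaf.stalk (p.base x) ⧸ IsLocalRing.maximalIdeal (Y.presheaf.stalk (p.base x))))
  haveI : IsFractionRing (Γ(Y, U) ⧸ (hU.primeIdealOf ⟨p.base x, x.2⟩).asIdeal)
      (IsLocalRing.ResidueField (Y.presheaf.stalk (p.base x))) :=
    isFractionRing_quotient_maximalIdeal (hU.primeIdealOf ⟨p.base x, x.2⟩).asIdeal
      (Y.presheaf.stalk (p.base x))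
  letI aSk : Algebra Γ(X, p ⁻¹ᵁ U) (IsLocalRing.ResidueField (X.presheaf.stalk (x : X))) :=
    inferInstanceAs (Algebra Γ(X, p ⁻¹ᵁ U) (X.presheaf.stalk (x : X) ⧸
      IsLocalRing.maximalIdeal (X.presheaf.stalk (x : X))))
  letI aSqk : Algebra (Γ(X, p ⁻¹ᵁ U) ⧸ (hU'.primeIdealOf x).asIdeal)
      (IsLocalRing.ResidueField (X.presheaf.stalk (x : X))) :=
    inferInstanceAs (Algebra (Γ(X, p ⁻¹ᵁ U) ⧸ (hU'.primeIdealOf x).asIdeal)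
      (X.presheaf.stalk (x : X) ⧸ IsLocalRing.maximalIdeal (X.presheaf.stalk (x : X))))
  haveI : IsScalarTower Γ(X, p ⁻¹ᵁ U) (Γ(X, p ⁻¹ᵁ U) ⧸ (hU'.primeIdealOf x).asIdeal)
      (IsLocalRing.ResidueField (X.presheaf.stalk (x : X))) :=
    inferInstanceAs (IsScalarTower Γ(X, p ⁻¹ᵁ U) (Γ(X, p ⁻¹ᵁ U) ⧸ (hU'.primeIdealOf x).asIdeal)
      (X.presheaf.stalk (x : X) ⧸ IsLocalRing.maximalIdeal (X.presheaf.stalk (x : X))))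
  haveI : IsFractionRing (Γ(X, p ⁻¹ᵁ U) ⧸ (hU'.primeIdealOf x).asIdeal)
      (IsLocalRing.ResidueField (X.presheaf.stalk (x : X))) :=
    isFractionRing_quotient_maximalIdeal (hU'.primeIdealOf x).asIdeal (X.presheaf.stalk (x : X))
  letI akk : Algebra (IsLocalRing.ResidueField (Y.presheaf.stalk (p.base x)))
      (IsLocalRing.ResidueField (X.presheaf.stalk (x : X))) :=
    (p.residueFieldMap (x : X)).hom.toAlgebra
  letI aRK : Algebra Γ(Y, U) (IsLocalRing.ResidueField (X.presheaf.stalk (x : X))) :=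
    ((algebraMap Γ(X, p ⁻¹ᵁ U) (IsLocalRing.ResidueField (X.presheaf.stalk (x : X)))).comp
      (algebraMap Γ(Y, U) Γ(X, p ⁻¹ᵁ U))).toAlgebra
  haveI : IsScalarTower Γ(Y, U) Γ(X, p ⁻¹ᵁ U)
      (IsLocalRing.ResidueField (X.presheaf.stalk (x : X))) :=
    IsScalarTower.of_algebraMap_eq fun _ ↦ rfl
  haveI : IsScalarTower Γ(Y, U) (IsLocalRing.ResidueField (Y.presheaf.stalk (p.base x)))
      (IsLocalRing.ResidueField (X.presheaf.stalk (x : X))) := by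
    refine IsScalarTower.of_algebraMap_eq fun r ↦ ?_
    have e1 : algebraMap Γ(Y, U) (IsLocalRing.ResidueField (X.presheaf.stalk (x : X))) r =
        X.residue (x : X) (X.presheaf.germ (p ⁻¹ᵁ U) x x.2 (p.app U r)) := rfl
    have e2 : algebraMap (IsLocalRing.ResidueField (Y.presheaf.stalk (p.base x)))
        (IsLocalRing.ResidueField (X.presheaf.stalk (x : X)))
        (algebraMap Γ(Y, U) (IsLocalRing.ResidueField (Y.presheaf.stalk (p.base x))) r) =
        p.residueFieldMap (x : X) (Y.residue (p.base x) (Y.presheaf.germ U (p.base x) x.2 r)) :=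
      rfl
    rw [e1, e2]
    have hcomp : Y.presheaf.germ U (p.base x) x.2 ≫ Y.residue (p.base x) ≫
        p.residueFieldMap (x : X) =
        p.app U ≫ X.presheaf.germ (p ⁻¹ᵁ U) x x.2 ≫ X.residue (x : X) := by
      rw [Scheme.residue_residueFieldMap, Scheme.Hom.germ_stalkMap_assoc]
    have := CategoryTheory.ConcreteCategory.congr_hom hcomp r
    simp only [CategoryTheory.ConcreteCategory.comp_apply] at this
    exact this.symm
  have h := Ideal.inertiaDeg_eq_of_isFractionRing (hU.primeIdealOf ⟨p.base x, x.2⟩).asIdeal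
    (hU'.primeIdealOf x).asIdeal (IsLocalRing.ResidueField (Y.presheaf.stalk (p.base x)))
    (IsLocalRing.ResidueField (X.presheaf.stalk (x : X)))
  rw [h]
  rfl

end DegChart

/-! ### Affine charts on which a morphism is finite -/

section FiniteChart

/-- If `p⁻¹(V) → V` is finite and `y ∈ V`, then `y` has an affine open neighbourhood `U ⊆ V` with
`p⁻¹(U)` affine and `Γ(Y, U) → Γ(X, p⁻¹U)` finite (Stacks 02RT, proof: "we may replace `Y` by
an affine open neighbourhood of `ξ` and assume that `p : X → Y` is finite. Write `Y = Spec(R)` and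
`X = Spec(A)` with `p` induced by a finite homomorphism `R → A`"). [folklore] -/
theorem exists_isAffineOpen_finite_app {X Y : Scheme.{u}} (p : X ⟶ Y) {V : Y.Opens} {y : Y}
    (hyV : y ∈ V) [IsFinite (p ∣_ V)] :
    ∃ U : Y.Opens, y ∈ U ∧ IsAffineOpen U ∧ IsAffineOpen (p ⁻¹ᵁ U) ∧ (p.app U).hom.Finite := by
  obtain ⟨_, ⟨U, hU, rfl⟩, hyU, hUV⟩ :=
    Y.isBasis_affineOpens.exists_subset_of_mem_open hyV V.2
  have hU : IsAffineOpen U := hU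
  -- `p⁻¹U → U` is finite: it is the restriction of `p⁻¹V → V` to `U ⊆ V`
  have hUV' : V.ι ''ᵁ (V.ι ⁻¹ᵁ U) = U := by
    simpa [Scheme.Hom.image_preimage_eq_opensRange_inf] using hUV
  haveI : IsFinite (p ∣_ U) := by
    have h1 : IsFinite (p ∣_ V ∣_ (V.ι ⁻¹ᵁ U)) := inferInstance
    rw [MorphismProperty.arrow_mk_iso_iff @IsFinite (morphismRestrictRestrict p V (V.ι ⁻¹ᵁ U)),
      hUV'] at h1
    exact h1
  haveI : IsAffine U := hU
  have hU' : IsAffineOpen (p ⁻¹ᵁ U) := isAffine_of_isAffineHom (p ∣_ U)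
  refine ⟨U, hyU, hU, hU', ?_⟩
  have hfin : ((p ∣_ U).appTop).hom.Finite := (p ∣_ U).finite_app ⊤ (isAffineOpen_top _)
  have E : (p ⁻¹ᵁ U).ι ''ᵁ ⊤ = p ⁻¹ᵁ (Scheme.Opens.ι U ''ᵁ ⊤) := by
    rw [Scheme.Opens.ι_image_top, Scheme.Opens.ι_image_top]
  have hg : (p ∣_ U).appTop = p.app (Scheme.Opens.ι U ''ᵁ ⊤) ≫ X.presheaf.map (eqToHom E).op :=
    morphismRestrict_appTop p U
  have hmm : X.presheaf.map (eqToHom E).op ≫ X.presheaf.map (eqToHom E.symm).op = 𝟙 _ := by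
    rw [← X.presheaf.map_comp, ← op_comp, eqToHom_trans, eqToHom_refl, op_id, X.presheaf.map_id]
  rw [hg] at hfin
  have hfin' : (p.app (Scheme.Opens.ι U ''ᵁ ⊤) ≫ X.presheaf.map (eqToHom E).op ≫
      X.presheaf.map (eqToHom E.symm).op).hom.Finite := by
    rw [← Category.assoc, CommRingCat.hom_comp]
    refine RingHom.Finite.comp (RingHom.Finite.of_surjective _ fun t ↦ ?_) hfin
    refine ⟨X.presheaf.map (eqToHom E).op t, ?_⟩
    change (X.presheaf.map (eqToHom E).op ≫ X.presheaf.map (eqToHom E.symm).op) t = t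
    rw [hmm]; rfl
  rw [hmm, Category.comp_id] at hfin'
  exact Scheme.Opens.ι_image_top U ▸ hfin'

end FiniteChart



/-! ### Towards the assembly: small lemmas -/

section Assembly

/-- `p^* : Γ(Y, U) → Γ(X, p⁻¹U)` is injective for `p` dominant between integral schemes (both rings
embed in the function fields, compatibly with the injective `p^♯ : K(Y) → K(X)`). [folklore] -/
theorem app_injective_of_isDominant {X Y : Scheme.{u}} [IsIntegral X] [IsIntegral Y] (p : X ⟶ Y)
    [IsDominant p] (U : Y.Opens) (x : X) (hx : p.base x ∈ U) :
    Function.Injective (p.app U).hom := by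
  haveI : Nonempty U := ⟨⟨p.base x, hx⟩⟩
  haveI : Nonempty (p ⁻¹ᵁ U) := ⟨⟨x, hx⟩⟩
  intro r r' h
  apply Y.germToFunctionField_injective U
  apply (RatFn.functionFieldMap p).injective
  rw [functionFieldMap_germToFunctionField p U r x hx,
    functionFieldMap_germToFunctionField p U r' x hx, h]

/-- Over a codimension-one point of the target of a closed dominant morphism of integral schemes
locally of finite type over a field of the same dimension `n`, every point of the fibre has the
dimension `n - 1` of that point. [folklore] -/
theorem height_eq_of_coheight_eq_one {K : Type u} [Field K] {X Y : Scheme.{u}} (p : X ⟶ Y)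
    (g : Y ⟶ Spec (.of K)) [IsIntegral X] [IsIntegral Y] [LocallyOfFiniteType g] [IsDominant p]
    (hpcl : IsClosedMap p.base) (n : ℕ) (hX : height (⊤ : X) = n) (hY : height (⊤ : Y) = n)
    {y : Y} (hy : coheight y = 1) (x : X) (hx : p.base x = y) :
    height x = height y ∧ height y + 1 = n := by
  have hyn : height y + 1 = n := by
    have h := Scheme.height_add_coheight_eq_height_top g y
    rwa [hy, hY] at h
  refine ⟨le_antisymm ?_ (hx ▸ height_base_le_of_isClosedMap p hpcl x), hyn⟩
  have hytop : y ≠ ⊤ := by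
    rintro rfl
    rw [coheight_top] at hy
    exact zero_ne_one hy
  have hxtop : x ≠ ⊤ := by
    rintro rfl
    apply hytop
    rw [← hx]
    exact RatFn.genericPoint_eq_of_isDominant p
  have hlt : height x < height (⊤ : X) :=
    height_strictMono (lt_top_of_ne_top hxtop)
      (lt_of_le_of_lt (height_mono le_top) (hX ▸ ENat.coe_lt_top n))
  rw [hX, ← hyn] at hlt
  exact Order.le_of_lt_add_one hlt

/-- Mathlib's `Scheme.ord g y` at a codimension-one point, in terms of `Ring.ordFrac 𝒪_{Y,y}`.
[folklore] -/
theorem ord_eq_toAdd_ordFrac {Y : Scheme.{u}} [IsIntegral Y] [IsLocallyNoetherian Y] {y : Y}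
    (hy : coheight y = 1) (g : Y.functionField) :
    haveI : Ring.KrullDimLE 1 (Y.presheaf.stalk y) := krullDimLE_of_coheight_le hy.le
    Scheme.ord g y =
      Multiplicative.toAdd (WithZero.unzeroD 1 (Ring.ordFrac (Y.presheaf.stalk y) g)) :=
  Scheme.ord_eq_ordHom_of_coheight_eq_one hy g

/-! ### The coefficient of a codimension-one point in `div(Nm b)` -/

/-- **`ord_y(Nm b)` on a finite chart** (Stacks 02RT, proof: "The coefficient of `[Z]` in
`div_Y(g)` is `ord_{R_𝔭}(g)`", combined with Tag 02MJ): for `p` dominant between integral schemes,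
`U = Spec R ∋ y` affine with `p⁻¹U = Spec A` affine and `R → A` finite, `y` of codimension one with
prime `𝔭`, and `b ∈ A ∖ 0`,
`ord_y(Nm (b|_{K(X)})) = Σ_{𝔮 ∣ 𝔭} [κ(𝔮):κ(𝔭)] ord_{A_𝔮}(b)`. [cite: StacksProject, Tag 02RT] -/
theorem ord_norm_germToFunctionField_eq {X Y : Scheme.{u}} [IsIntegral X] [IsIntegral Y]
    [IsLocallyNoetherian X] [IsLocallyNoetherian Y] (p : X ⟶ Y) [IsDominant p] {U : Y.Opens}
    (hU : IsAffineOpen U) (hU' : IsAffineOpen (p ⁻¹ᵁ U)) (hfin : (p.app U).hom.Finite) (y : U)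
    (hy : coheight (y : Y) = 1) (x₀ : X) (hx₀ : p.base x₀ = y) (b : Γ(X, p ⁻¹ᵁ U)) (hb : b ≠ 0) :
    haveI : Nonempty (p ⁻¹ᵁ U) := ⟨⟨x₀, show p.base x₀ ∈ U from hx₀ ▸ y.2⟩⟩
    letI : Algebra Γ(Y, U) Γ(X, p ⁻¹ᵁ U) := (p.app U).hom.toAlgebra
    Scheme.ord (RatFn.norm p (X.germToFunctionField (p ⁻¹ᵁ U) b)) (y : Y) =
      ((∑ᶠ q : (hU.primeIdealOf y).asIdeal.primesOver Γ(X, p ⁻¹ᵁ U),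
        (q.1.inertiaDeg Γ(Y, U) : ℕ∞) * Ring.ord (Localization.AtPrime q.1)
          (algebraMap Γ(X, p ⁻¹ᵁ U) (Localization.AtPrime q.1) b)).toNat : ℤ) := by
  have hx₀U : p.base x₀ ∈ U := hx₀ ▸ y.2
  haveI : Nonempty (p ⁻¹ᵁ U) := ⟨⟨x₀, hx₀U⟩⟩
  haveI : Nonempty U := ⟨y⟩
  letI : Algebra Γ(Y, U) Γ(X, p ⁻¹ᵁ U) := (p.app U).hom.toAlgebra
  haveI : Module.Finite Γ(Y, U) Γ(X, p ⁻¹ᵁ U) := hfin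
  haveI : FaithfulSMul Γ(Y, U) Γ(X, p ⁻¹ᵁ U) :=
    (faithfulSMul_iff_algebraMap_injective _ _).mpr (app_injective_of_isDominant p U x₀ hx₀U)
  haveI : IsNoetherianRing Γ(Y, U) := IsLocallyNoetherian.component_noetherian ⟨U, hU⟩
  haveI : Ring.KrullDimLE 1 (Y.presheaf.stalk (y : Y)) := krullDimLE_of_coheight_le hy.le
  haveI := hU.isLocalization_stalk y
  haveI : IsFractionRing Γ(Y, U) Y.functionField :=
    functionField_isFractionRing_of_isAffineOpen Y U hU
  haveI : IsFractionRing Γ(X, p ⁻¹ᵁ U) X.functionField :=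
    functionField_isFractionRing_of_isAffineOpen X (p ⁻¹ᵁ U) hU'
  -- the function field extension `K(Y) ⊆ K(X)`
  letI : Algebra Y.functionField X.functionField := (RatFn.functionFieldMap p).toAlgebra
  letI : Algebra Γ(Y, U) X.functionField :=
    ((algebraMap Γ(X, p ⁻¹ᵁ U) X.functionField).comp (algebraMap Γ(Y, U) Γ(X, p ⁻¹ᵁ U))).toAlgebra
  haveI : IsScalarTower Γ(Y, U) Γ(X, p ⁻¹ᵁ U) X.functionField :=
    IsScalarTower.of_algebraMap_eq fun _ ↦ rfl
  haveI : IsScalarTower Γ(Y, U) Y.functionField X.functionField := by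
    refine IsScalarTower.of_algebraMap_eq fun r ↦ ?_
    change algebraMap Γ(X, p ⁻¹ᵁ U) X.functionField (p.app U r) =
      RatFn.functionFieldMap p (Y.germToFunctionField U r)
    rw [functionFieldMap_germToFunctionField p U r x₀ hx₀U]
    rfl
  haveI : FiniteDimensional Y.functionField X.functionField :=
    finiteDimensional_of_isFractionRing Γ(Y, U) Γ(X, p ⁻¹ᵁ U) Y.functionField X.functionField
  -- the localised extension `𝒪_{Y,y} = R_𝔭 ⊆ A_𝔭`
  letI : Algebra (Y.presheaf.stalk (y : Y))
      (Localization (Algebra.algebraMapSubmonoid Γ(X, p ⁻¹ᵁ U)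
        (hU.primeIdealOf y).asIdeal.primeCompl)) :=
    localizationAlgebra (hU.primeIdealOf y).asIdeal.primeCompl Γ(X, p ⁻¹ᵁ U)
  haveI : IsScalarTower Γ(Y, U) (Y.presheaf.stalk (y : Y))
      (Localization (Algebra.algebraMapSubmonoid Γ(X, p ⁻¹ᵁ U)
        (hU.primeIdealOf y).asIdeal.primeCompl)) :=
    isScalarTower_localizationAlgebra (hU.primeIdealOf y).asIdeal.primeCompl Γ(X, p ⁻¹ᵁ U)
  have H := ordFrac_norm_eq_finsum_primesOver (hU.primeIdealOf y).asIdeal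
    (Y.presheaf.stalk (y : Y)) (Localization (Algebra.algebraMapSubmonoid Γ(X, p ⁻¹ᵁ U)
      (hU.primeIdealOf y).asIdeal.primeCompl)) (K := Y.functionField) (L := X.functionField) b hb
  rw [ord_eq_toAdd_ordFrac hy, RatFn.norm_apply]
  change Multiplicative.toAdd (WithZero.unzeroD 1 (Ring.ordFrac (Y.presheaf.stalk (y : Y))
    (Algebra.norm Y.functionField (algebraMap Γ(X, p ⁻¹ᵁ U) X.functionField b)))) = _
  rw [H, WithZero.unzeroD_coe, toAdd_ofAdd]

/-- Finiteness of `ord_{A_𝔮}(b)` at the prime of a codimension-one point (via `𝒪_{X,x} = A_𝔮`).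
[folklore] -/
theorem ord_localization_primeIdealOf_ne_top {X : Scheme.{u}} [IsIntegral X] [IsLocallyNoetherian X]
    {V : X.Opens} (hV : IsAffineOpen V) (x : V) (hxc : coheight (x : X) = 1) (b : Γ(X, V))
    (hb : b ≠ 0) :
    Ring.ord (Localization.AtPrime (hV.primeIdealOf x).asIdeal)
      (algebraMap Γ(X, V) (Localization.AtPrime (hV.primeIdealOf x).asIdeal) b) ≠ ⊤ := by
  haveI : Ring.KrullDimLE 1 (X.presheaf.stalk (x : X)) := krullDimLE_of_coheight_le hxc.le
  haveI := hV.isLocalization_stalk x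
  let e := IsLocalization.algEquiv (hV.primeIdealOf x).asIdeal.primeCompl
    (X.presheaf.stalk (x : X)) (Localization.AtPrime (hV.primeIdealOf x).asIdeal)
  have hgerm0 : algebraMap Γ(X, V) (X.presheaf.stalk (x : X)) b ≠ 0 := by
    rw [TopCat.Presheaf.stalk_open_algebraMap]
    exact (map_ne_zero_iff _ (germ_injective_of_isIntegral X (x : X) x.2)).mpr hb
  rw [← e.commutes b, show (e : _ → _) = e.toRingEquiv from rfl, ord_ringEquiv e.toRingEquiv]
  exact Ring.ord_ne_top (mem_nonZeroDivisors_of_ne_zero hgerm0)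

/-- **The coefficient of a codimension-one point in `p_* div(b)`, on a finite chart** (Stacks 02RT,
proof: "The coefficient of `[Z]` in `p_* div_X(f)` is
`Σ_{𝔮 lying over 𝔭} [κ(𝔮):κ(𝔭)] ord_{A_𝔮}(f)`"): with the notation of
`ord_norm_germToFunctionField_eq`, the points `x` over `y` correspond to the primes `𝔮 ∣ 𝔭` of
`A` (`x ↦ 𝔮_x`), with `ord_x(b) = ord_{A_𝔮}(b)` and `[κ(x):κ(y)] = [κ(𝔮):κ(𝔭)]`.
[cite: StacksProject, Tag 02RT] -/
theorem finsum_ord_mul_residueDegree_eq {X Y : Scheme.{u}} [IsIntegral X] [IsIntegral Y]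
    [IsLocallyNoetherian X] (p : X ⟶ Y) {U : Y.Opens}
    (hU : IsAffineOpen U) (hU' : IsAffineOpen (p ⁻¹ᵁ U)) (hfin : (p.app U).hom.Finite) (y : U)
    (hfibc : ∀ x : X, p.base x = y → coheight x = 1) (x₀ : X) (hx₀ : p.base x₀ = y)
    (b : Γ(X, p ⁻¹ᵁ U)) (hb : b ≠ 0) :
    haveI : Nonempty (p ⁻¹ᵁ U) := ⟨⟨x₀, show p.base x₀ ∈ U from hx₀ ▸ y.2⟩⟩
    letI : Algebra Γ(Y, U) Γ(X, p ⁻¹ᵁ U) := (p.app U).hom.toAlgebra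
    (∑ᶠ x ∈ p.base ⁻¹' {(y : Y)}, Scheme.ord (X.germToFunctionField (p ⁻¹ᵁ U) b) x *
        (p.residueDegree x : ℤ)) =
      ((∑ᶠ q : (hU.primeIdealOf y).asIdeal.primesOver Γ(X, p ⁻¹ᵁ U),
        (q.1.inertiaDeg Γ(Y, U) : ℕ∞) * Ring.ord (Localization.AtPrime q.1)
          (algebraMap Γ(X, p ⁻¹ᵁ U) (Localization.AtPrime q.1) b)).toNat : ℤ) := by
  have hx₀U : p.base x₀ ∈ U := hx₀ ▸ y.2
  haveI : Nonempty (p ⁻¹ᵁ U) := ⟨⟨x₀, hx₀U⟩⟩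
  letI : Algebra Γ(Y, U) Γ(X, p ⁻¹ᵁ U) := (p.app U).hom.toAlgebra
  have hmemU : ∀ x : X, p.base x = y → p.base x ∈ U := fun x hx ↦ hx ▸ y.2
  -- the bijection `x ↦ 𝔮_x` between the fibre and the primes over `𝔭`
  have hover : ∀ (x : X) (hx : p.base x = y), (hU'.primeIdealOf ⟨x, hmemU x hx⟩).asIdeal.LiesOver
      (hU.primeIdealOf y).asIdeal := fun x hx ↦ ⟨by
    rw [Ideal.under_def, RingHom.algebraMap_toAlgebra, comap_app_primeIdealOf p hU hU' ⟨x, _⟩]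
    congr 3
    exact Subtype.ext hx.symm⟩
  have hfromSpec : ∀ q : (hU.primeIdealOf y).asIdeal.primesOver Γ(X, p ⁻¹ᵁ U),
      p.base (hU'.fromSpec ⟨q.1, q.2.1⟩) = y := by
    intro q
    have h1 := congrArg (fun f ↦ f.base ⟨q.1, q.2.1⟩)
      (IsAffineOpen.SpecMap_appLE_fromSpec p hU hU' (le_refl (p ⁻¹ᵁ U)))
    simp only [Scheme.Hom.comp_base, TopCat.coe_comp, Function.comp_apply] at h1
    rw [← h1, ← hU.fromSpec_primeIdealOf y]
    congr 1
    apply PrimeSpectrum.ext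
    change q.1.comap (p.appLE U (p ⁻¹ᵁ U) le_rfl).hom = (hU.primeIdealOf y).asIdeal
    rw [← Scheme.Hom.app_eq_appLE]
    exact (q.2.2.over).symm
  have hprime : ∀ q : (hU.primeIdealOf y).asIdeal.primesOver Γ(X, p ⁻¹ᵁ U),
      hU'.primeIdealOf ⟨hU'.fromSpec ⟨q.1, q.2.1⟩, hmemU _ (hfromSpec q)⟩ = ⟨q.1, q.2.1⟩ := by
    intro q
    apply hU'.fromSpec.isOpenEmbedding.injective
    rw [IsAffineOpen.fromSpec_primeIdealOf]
  let e : ↥(p.base ⁻¹' {(y : Y)}) ≃ (hU.primeIdealOf y).asIdeal.primesOver Γ(X, p ⁻¹ᵁ U) :=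
    { toFun := fun x ↦ ⟨(hU'.primeIdealOf ⟨x.1, hmemU x.1 x.2⟩).asIdeal, inferInstance,
        hover x.1 x.2⟩
      invFun := fun q ↦ ⟨hU'.fromSpec ⟨q.1, q.2.1⟩, hfromSpec q⟩
      left_inv := fun x ↦ Subtype.ext (hU'.fromSpec_primeIdealOf ⟨x.1, hmemU x.1 x.2⟩)
      right_inv := fun q ↦ Subtype.ext (congrArg PrimeSpectrum.asIdeal (hprime q)) }
  -- finiteness of the local orders, and of the index set
  have hfinord : ∀ q : (hU.primeIdealOf y).asIdeal.primesOver Γ(X, p ⁻¹ᵁ U),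
      Ring.ord (Localization.AtPrime q.1) (algebraMap Γ(X, p ⁻¹ᵁ U) _ b) ≠ ⊤ := by
    intro q
    obtain ⟨x, rfl⟩ := e.surjective q
    exact ord_localization_primeIdealOf_ne_top hU' ⟨x.1, hmemU x.1 x.2⟩ (hfibc x.1 x.2) b hb
  haveI : Module.Finite Γ(Y, U) Γ(X, p ⁻¹ᵁ U) := hfin
  haveI : Finite ((hU.primeIdealOf y).asIdeal.primesOver Γ(X, p ⁻¹ᵁ U)) :=
    (Algebra.QuasiFinite.finite_primesOver _).to_subtype
  haveI : Finite ↥(p.base ⁻¹' {(y : Y)}) := Finite.of_equiv _ e.symm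
  -- termwise identification along `e`
  have hterm : ∀ x : ↥(p.base ⁻¹' {(y : Y)}),
      Scheme.ord (X.germToFunctionField (p ⁻¹ᵁ U) b) x.1 * (p.residueDegree x.1 : ℤ) =
        ((((e x).1.inertiaDeg Γ(Y, U)) * (Ring.ord (Localization.AtPrime (e x).1)
          (algebraMap Γ(X, p ⁻¹ᵁ U) _ b)).toNat : ℕ) : ℤ) := by
    intro x
    have h1 := ord_germToFunctionField_eq hU' ⟨x.1, hmemU x.1 x.2⟩ (hfibc x.1 x.2) b hb
    have h2 := residueDegree_eq_inertiaDeg p hU' hU ⟨x.1, hmemU x.1 x.2⟩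
    rw [h1, h2, Nat.cast_mul, mul_comm]
    rfl
  -- the right-hand side as a finite sum of natural numbers
  have hrhs : (∑ᶠ q : (hU.primeIdealOf y).asIdeal.primesOver Γ(X, p ⁻¹ᵁ U),
      (q.1.inertiaDeg Γ(Y, U) : ℕ∞) * Ring.ord (Localization.AtPrime q.1)
        (algebraMap Γ(X, p ⁻¹ᵁ U) (Localization.AtPrime q.1) b)) =
      ((∑ᶠ q : (hU.primeIdealOf y).asIdeal.primesOver Γ(X, p ⁻¹ᵁ U),
        q.1.inertiaDeg Γ(Y, U) * (Ring.ord (Localization.AtPrime q.1)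
          (algebraMap Γ(X, p ⁻¹ᵁ U) (Localization.AtPrime q.1) b)).toNat : ℕ) : ℕ∞) := by
    rw [Nat.cast_finsum]
    refine finsum_congr fun q ↦ ?_
    rw [Nat.cast_mul, ENat.coe_toNat (hfinord q)]
  rw [hrhs, ENat.toNat_coe, Nat.cast_finsum, ← finsum_set_coe_eq_finsum_mem,
    ← finsum_comp_equiv e.symm]
  refine finsum_congr fun q ↦ ?_
  rw [hterm, Equiv.apply_symm_apply]

/-- `K(X)` is finite over `K(Y)` (through `p^♯`) as soon as some `Γ(Y, U) → Γ(X, p⁻¹U)` is finite on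
non-empty affine charts. [folklore] -/
theorem finiteDimensional_functionField_of_finite_app {X Y : Scheme.{u}} [IsIntegral X]
    [IsIntegral Y] (p : X ⟶ Y) [IsDominant p] {U : Y.Opens} (hU : IsAffineOpen U)
    (hU' : IsAffineOpen (p ⁻¹ᵁ U)) (hfin : (p.app U).hom.Finite) (x₀ : X) (hx₀ : p.base x₀ ∈ U) :
    letI : Algebra Y.functionField X.functionField := (RatFn.functionFieldMap p).toAlgebra
    FiniteDimensional Y.functionField X.functionField := by
  haveI : Nonempty (p ⁻¹ᵁ U) := ⟨⟨x₀, hx₀⟩⟩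
  haveI : Nonempty U := ⟨⟨p.base x₀, hx₀⟩⟩
  letI : Algebra Γ(Y, U) Γ(X, p ⁻¹ᵁ U) := (p.app U).hom.toAlgebra
  haveI : Module.Finite Γ(Y, U) Γ(X, p ⁻¹ᵁ U) := hfin
  haveI : FaithfulSMul Γ(Y, U) Γ(X, p ⁻¹ᵁ U) :=
    (faithfulSMul_iff_algebraMap_injective _ _).mpr (app_injective_of_isDominant p U x₀ hx₀)
  haveI : IsFractionRing Γ(Y, U) Y.functionField :=
    functionField_isFractionRing_of_isAffineOpen Y U hU
  haveI : IsFractionRing Γ(X, p ⁻¹ᵁ U) X.functionField :=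
    functionField_isFractionRing_of_isAffineOpen X (p ⁻¹ᵁ U) hU'
  letI : Algebra Y.functionField X.functionField := (RatFn.functionFieldMap p).toAlgebra
  letI : Algebra Γ(Y, U) X.functionField :=
    ((algebraMap Γ(X, p ⁻¹ᵁ U) X.functionField).comp (algebraMap Γ(Y, U) Γ(X, p ⁻¹ᵁ U))).toAlgebra
  haveI : IsScalarTower Γ(Y, U) Γ(X, p ⁻¹ᵁ U) X.functionField :=
    IsScalarTower.of_algebraMap_eq fun _ ↦ rfl
  haveI : IsScalarTower Γ(Y, U) Y.functionField X.functionField := by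
    refine IsScalarTower.of_algebraMap_eq fun r ↦ ?_
    change algebraMap Γ(X, p ⁻¹ᵁ U) X.functionField (p.app U r) =
      RatFn.functionFieldMap p (Y.germToFunctionField U r)
    rw [functionFieldMap_germToFunctionField p U r x₀ hx₀]
    rfl
  exact finiteDimensional_of_isFractionRing Γ(Y, U) Γ(X, p ⁻¹ᵁ U) Y.functionField X.functionField

/-! ### Discharge of `Literature.AlgebraicGeometry.Motives.map_div_eq_div_norm` (Stacks 02RT) -/

/-- **Stacks, Chow Homology, Lemma 42.18.1 (Tag 02RT): `p_* div_X(f) = div_Y(Nm f)`** for a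
proper dominant morphism `p : X → Y` of integral schemes locally of finite type over a field of
the same dimension — discharge of the named fact
`Literature.AlgebraicGeometry.Motives.map_div_eq_div_norm`. Proof as printed: at a point `y` of
codimension one, `p` is finite over an affine neighbourhood `Spec R ∋ y` (Tag 02RM,
`Literature.AlgebraicGeometry.Motives.exists_isFinite_morphismRestrict_of_coheight_eq_one`) with
`p⁻¹(Spec R) = Spec A`, `R → A` finite; writing `f = b/b'` with `b, b' ∈ A`, the coefficient of
`y` in `p_* div(b)` is `Σ_{𝔮 ∣ 𝔭} [κ(𝔮):κ(𝔭)] ord_{A_𝔮}(b)`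
(`Literature.AlgebraicGeometry.Motives.finsum_ord_mul_residueDegree_eq`) and in `div(Nm b)` it is
`ord_{R_𝔭}(Nm b)`, and these agree by Tag 02MJ
(`Literature.AlgebraicGeometry.Motives.ord_norm_germToFunctionField_eq`); at points of other
codimensions both sides vanish. [cite: StacksProject, Tag 02RT] -/
theorem map_div_eq_div_norm_holds : map_div_eq_div_norm.{u} := by
  intro k _ X Y p _ _ _ _ _ _ _ _ n hX hY f hf c hc
  classical
  haveI : LocallyOfFiniteType (p.left ≫ Y.hom) := by rw [Over.w p]; infer_instance
  haveI : LocallyOfFiniteType p.left := locallyOfFiniteType_of_comp p.left Y.hom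
  funext y
  simp only [AlgebraicCycle.map, Function.locallyFinsupp.map_apply, hc]
  -- dimension bookkeeping
  have hdimX : ∀ x : X.left, height x + coheight x = n := fun x ↦
    hX ▸ Scheme.height_add_coheight_eq_height_top X.hom x
  have hdimY : height y + coheight y = n := hY ▸ Scheme.height_add_coheight_eq_height_top Y.hom y
  by_cases hy1 : coheight y = 1
  swap
  · -- both sides vanish away from codimension one
    rw [Scheme.ord_eq_zero_of_coheight_neq_one hy1]
    refine finsum_mem_of_eqOn_zero fun x hx ↦ ?_
    simp only [Set.mem_preimage, Set.mem_singleton_iff] at hx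
    simp only [Pi.zero_apply, AlgebraicCycle.mapCoeff]
    by_cases hxc : coheight x = 1
    · -- `height x = n - 1 ≠ height y`
      rw [if_neg, Nat.cast_zero, mul_zero]
      intro hxy
      apply hy1
      have h1 := hdimX x
      rw [hxc, hxy, hx] at h1
      have hfin : height y ≠ ⊤ := by
        intro htop; rw [htop, top_add] at h1; exact (ENat.coe_ne_top n) h1.symm
      rw [← h1] at hdimY
      exact WithTop.add_left_cancel hfin hdimY
    · rw [Scheme.ord_eq_zero_of_coheight_neq_one hxc, zero_mul]
  -- codimension one.  A point `x₀` over `y` (`p` is closed and dominant, hence surjective)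
  obtain ⟨x₀, hx₀⟩ : y ∈ Set.range p.left.base := by
    rw [← p.left.isClosedMap.isClosed_range.closure_eq, p.left.denseRange.closure_range]
    exact Set.mem_univ y
  -- a finite affine chart `Spec A = p⁻¹(Spec R) → Spec R ∋ y` (Tag 02RM)
  obtain ⟨V, hyV, hV⟩ :=
    exists_isFinite_morphismRestrict_of_coheight_eq_one p.left Y.hom n hX hY hy1
  obtain ⟨U, hyU, hU, hU', hfin⟩ := exists_isAffineOpen_finite_app p.left hyV
  have hx₀U : p.left.base x₀ ∈ U := hx₀ ▸ hyU
  haveI : Nonempty (p.left ⁻¹ᵁ U) := ⟨⟨x₀, hx₀U⟩⟩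
  haveI : IsFractionRing Γ(X.left, p.left ⁻¹ᵁ U) X.left.functionField :=
    functionField_isFractionRing_of_isAffineOpen _ _ hU'
  -- dimensions along the fibre
  have hfib : ∀ x : X.left, p.left.base x = y → height x = height y ∧ coheight x = 1 := by
    intro x hx
    obtain ⟨hxy, hyn⟩ :=
      height_eq_of_coheight_eq_one p.left Y.hom p.left.isClosedMap n hX hY hy1 x hx
    refine ⟨hxy, ?_⟩
    have h1 := hdimX x
    rw [hxy, ← hyn] at h1
    have hfin' : height y ≠ ⊤ := by
      intro htop; rw [htop, top_add] at hyn; exact (ENat.coe_ne_top n) hyn.symm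
    exact WithTop.add_left_cancel hfin' h1
  -- `f = b / b'` with `b, b' ∈ A`
  obtain ⟨b, b', hb', hfbb⟩ := IsFractionRing.div_surjective (A := Γ(X.left, p.left ⁻¹ᵁ U)) f
  have hb'0 : b' ≠ 0 := nonZeroDivisors.ne_zero hb'
  have halg : ∀ a : Γ(X.left, p.left ⁻¹ᵁ U), algebraMap _ X.left.functionField a =
      X.left.germToFunctionField (p.left ⁻¹ᵁ U) a := fun _ ↦ rfl
  have hgb'0 : X.left.germToFunctionField (p.left ⁻¹ᵁ U) b' ≠ 0 := by
    rw [← halg]; exact (map_ne_zero_iff _ (IsFractionRing.injective _ _)).mpr hb'0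
  have hb0 : b ≠ 0 := by
    rintro rfl
    apply hf
    rw [← hfbb, map_zero, zero_div]
  have hgb0 : X.left.germToFunctionField (p.left ⁻¹ᵁ U) b ≠ 0 := by
    rw [← halg]; exact (map_ne_zero_iff _ (IsFractionRing.injective _ _)).mpr hb0
  have hfmul : f * X.left.germToFunctionField (p.left ⁻¹ᵁ U) b' =
      X.left.germToFunctionField (p.left ⁻¹ᵁ U) b := by
    rw [← hfbb, ← halg, ← halg, div_mul_cancel₀ _ ((halg b').symm ▸ hgb'0)]
  -- orders of `f` along the fibre and of `Nm f` at `y`, as differences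
  have hordx : ∀ x : X.left, Scheme.ord f x =
      Scheme.ord (X.left.germToFunctionField (p.left ⁻¹ᵁ U) b) x -
        Scheme.ord (X.left.germToFunctionField (p.left ⁻¹ᵁ U) b') x := by
    intro x
    rw [← hfmul, Scheme.ord_mul hf hgb'0]
    ring
  letI : Algebra Y.left.functionField X.left.functionField :=
    (RatFn.functionFieldMap p.left).toAlgebra
  haveI : FiniteDimensional Y.left.functionField X.left.functionField :=
    finiteDimensional_functionField_of_finite_app p.left hU hU' hfin x₀ hx₀U
  have hnorm0 : ∀ g : X.left.functionField, g ≠ 0 → RatFn.norm p.left g ≠ 0 := fun g hg ↦ by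
    rw [RatFn.norm_apply]; exact Algebra.norm_ne_zero_iff.mpr hg
  have hordy : Scheme.ord (RatFn.norm p.left f) y =
      Scheme.ord (RatFn.norm p.left (X.left.germToFunctionField (p.left ⁻¹ᵁ U) b)) y -
        Scheme.ord (RatFn.norm p.left (X.left.germToFunctionField (p.left ⁻¹ᵁ U) b')) y := by
    rw [← hfmul, map_mul, Scheme.ord_mul (hnorm0 f hf) (hnorm0 _ hgb'0)]
    ring
  -- the two sides, for `b` and for `b'`
  have hA := fun (a : Γ(X.left, p.left ⁻¹ᵁ U)) (ha : a ≠ 0) ↦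
    ord_norm_germToFunctionField_eq p.left hU hU' hfin ⟨y, hyU⟩ hy1 x₀ hx₀ a ha
  have hB := fun (a : Γ(X.left, p.left ⁻¹ᵁ U)) (ha : a ≠ 0) ↦
    finsum_ord_mul_residueDegree_eq p.left hU hU' hfin ⟨y, hyU⟩ (fun x hx ↦ (hfib x hx).2) x₀
      hx₀ a ha
  have hAB : ∀ a : Γ(X.left, p.left ⁻¹ᵁ U), a ≠ 0 →
      (∑ᶠ x ∈ p.left.base ⁻¹' {y},
        Scheme.ord (X.left.germToFunctionField (p.left ⁻¹ᵁ U) a) x * (p.left.residueDegree x : ℤ)) =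
        Scheme.ord (RatFn.norm p.left (X.left.germToFunctionField (p.left ⁻¹ᵁ U) a)) y :=
    fun a ha ↦ (hB a ha).trans (hA a ha).symm
  -- assemble
  have hfinite : (p.left.base ⁻¹' {y}).Finite :=
    finite_preimage_singleton_of_coheight_eq_one p.left Y.hom p.left.isClosedMap n hX hY hy1
  rw [hordy, ← hAB b hb0, ← hAB b' hb'0, ← finsum_mem_sub_distrib _ _ hfinite]
  refine finsum_mem_congr rfl fun x hx ↦ ?_
  simp only [Set.mem_preimage, Set.mem_singleton_iff] at hx
  simp only [AlgebraicCycle.mapCoeff, hx, (hfib x hx).1, if_true, hordx x]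
  ring

end Assembly

end Literature.AlgebraicGeometry.Motives

end
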